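import Literature.Probability.Percolation.TrapPairCrossClean
import Literature.Probability.Percolation.TrapPairAvoid
import Literature.Probability.Percolation.ArmSeparationRotate
import Literature.Probability.Percolation.OneArmBoundaryArms
import HarnessLib

/-!
# The cross-frame pair step: the avoidance hypotheses from the position of the fences

Topic `Literature/Probability/Percolation`; family `crit-perc` / near-critical percolation on `𝕋`.
A brick of the near-critical arm-separation theorem for four arms in the ADJACENT colour
arrangement (P. Nolin, EJP 13 (2008), Thm. 11, `j = 4`, `σ = BBWW` [arXiv 0711.4948: Thm. 10];
the input `hsepAdj` of `Werner2009_lemma63_of_altSeparation_of_adjSeparation`).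

`CrossData.exists_two_clean_routes` (`TrapPairCrossClean.lean`) needs, for each structure, a
route avoiding every fence site of the OTHER structure. When the two frames are the rotations
`ρ^{i₁}`, `ρ^{i₂}` (`i₁ ≠ i₂ < 6`) the fence sites of `D₁`, read in the frame of `D₂` through
`ψ = ρ^{i₁ - i₂}`, lie in squares of half-width `2k + 1` about points of the side `i₁`:

* `i₂ = i₁ + 1` (`ψ = ρ⁵`): the side `i₁` is the BOTTOM side of the frame of `D₂`; a fence connection
  of `D₁` meeting the trapezoid of `D₂` leaves it only through the bottom row `trapB` — provided its
  square does not straddle the inner column `{v₀ = M + 1}`, i.e. the tip is not within `8k` of the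
  MIDPOINT of the side (`hang_bottom_of_box`); then `PairDataB.route_d_avoid` applies;
* `i₂ = i₁ - 1` (`ψ = ρ`): the side `i₁` is the TOP side; the connection hangs from `trapU`
  (`hang_top_of_box`) and `PairDataB.route_c_avoid` applies;
* otherwise the squares miss the trapezoid of `D₂` altogether (`rot_not_mem_trapD_of_box`).

Hence the avoidance hypotheses under MIDPOINT GUARDS on the tips of all terms
(`CrossData.avoid₂_of_rot`, `CrossData.avoid₁_of_rot`) and the cross-frame clean routes
(`CrossData.exists_two_clean_routes_of_rot`).

Everything here is proved; no named facts are introduced.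

## References

* P. Nolin, Near-critical percolation in two dimensions, *Electron. J. Probab.* 13 (2008), §4.4,
  proof of Lemma 15 and of Thm. 11 (arXiv 0711.4948: Lemma 14, Thm. 10) [Nolin2008].
-/

noncomputable section

open Set

namespace Literature.Probability.Percolation

open LatticeModels
open PairData (term_isCrossing term_eq tip_mem)

/-! ### Rotations in coordinates -/

/-- `ρ u = (-u₁, u₀ + u₁)`. [folklore] -/
theorem triRotIsoPow_one_coord (u : Site 2) : triRotIsoPow 1 u 0 = -u 1 ∧ triRotIsoPow 1 u 1 = u 0 + u 1 := by
  simp only [triRotIsoPow_succ_apply, triRotIsoPow_zero_apply, triRot60_apply_zero, triRot60_apply_one, and_self]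

/-- `ρ² u = (-u₀ - u₁, u₀)`. [folklore] -/
theorem triRotIsoPow_two_coord (u : Site 2) : triRotIsoPow 2 u 0 = -u 0 - u 1 ∧ triRotIsoPow 2 u 1 = u 0 := by
  simp only [triRotIsoPow_succ_apply, triRotIsoPow_zero_apply, triRot60_apply_zero, triRot60_apply_one]
  constructor <;> ring

/-- `ρ³ u = (-u₀, -u₁)`. [folklore] -/
theorem triRotIsoPow_three_coord (u : Site 2) : triRotIsoPow 3 u 0 = -u 0 ∧ triRotIsoPow 3 u 1 = -u 1 := by
  simp only [triRotIsoPow_succ_apply, triRotIsoPow_zero_apply, triRot60_apply_zero, triRot60_apply_one]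
  constructor <;> ring

/-- `ρ⁴ u = (u₁, -u₀ - u₁)`. [folklore] -/
theorem triRotIsoPow_four_coord (u : Site 2) : triRotIsoPow 4 u 0 = u 1 ∧ triRotIsoPow 4 u 1 = -u 0 - u 1 := by
  simp only [triRotIsoPow_succ_apply, triRotIsoPow_zero_apply, triRot60_apply_zero, triRot60_apply_one]
  constructor <;> ring

/-- `ρ⁵ u = (u₀ + u₁, -u₀)`. [folklore] -/
theorem triRotIsoPow_five_coord (u : Site 2) : triRotIsoPow 5 u 0 = u 0 + u 1 ∧ triRotIsoPow 5 u 1 = -u 0 := by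
  simp only [triRotIsoPow_succ_apply, triRotIsoPow_zero_apply, triRot60_apply_zero, triRot60_apply_one]
  constructor <;> ring

/-- `(ρ^{i₂})⁻¹ ∘ ρ^{i₁} = ρ^{(i₁ + 6 - i₂) % 6}` (`i₂ ≤ 6`). [folklore] -/
theorem triRotIsoPow_symm_comp_apply {i₁ i₂ : ℕ} (hi₂ : i₂ ≤ 6) (u : Site 2) :
    (triRotIsoPow i₂).symm (triRotIsoPow i₁ u) = triRotIsoPow ((i₁ + (6 - i₂)) % 6) u := by
  rw [RelIso.symm_apply_eq, triRotIsoPow_mod_six_apply, triRotIsoPow_add_apply, ← triRotIsoPow_add_apply (6 - i₂) i₂,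
    show 6 - i₂ + i₂ = 0 + 6 by omega, triRotIsoPow_add_six_apply, triRotIsoPow_zero_apply]

/-- The sum of the coordinates changes by at most one along an edge of `𝕋`. [folklore] -/
theorem triGraph_adj_sum {x y : Site 2} (h : triGraph.Adj x y) : x 0 + x 1 - 1 ≤ y 0 + y 1 ∧ y 0 + y 1 ≤ x 0 + x 1 + 1 := by
  rcases triGraph_adj_cases h with h | h | h | h | h | h <;> omega

/-! ### Squares about a point of the side `0`, read through a rotation -/

section Box

variable {F : Set (Site 2)} {M k : ℕ} {t : ℤ}

/-- **A connection in a square about `(2M, t)` read through `ρ⁵` hangs from the bottom row.** If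
`F` lies in the square of half-width `2k + 1` about `(2M, t)`, every site of `F` is joined inside
`F` to a site of norm `> 2M`, the square is past the midpoint column (`M + 4k + 4 ≤ 2M + t`) and
below the corner (`t + 4k + 2 < 0`), then every site of `ρ⁵ F` in the trapezoid is joined inside
`ρ⁵ F ∩ trapD` to a site of the bottom row `trapB`. [folklore] -/
theorem hang_bottom_of_box
    (hbox : ∀ y ∈ F, 2 * (M : ℤ) - (2 * k + 1) ≤ y 0 ∧ y 0 ≤ 2 * M + (2 * k + 1) ∧ t - (2 * k + 1) ≤ y 1 ∧ y 1 ≤ t + (2 * k + 1))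
    (hconn : ∃ m ∈ F, 2 * (M : ℤ) < triNorm m ∧ ∀ x ∈ F, PathIn triGraph F x m)
    (hguard : (M : ℤ) + 4 * k + 4 ≤ 2 * M + t) (htop : t + 4 * k + 2 < 0) :
    ∀ x ∈ F, triRotIsoPow 5 x ∈ trapD M →
      ∃ x' ∈ trapB M, PathIn triGraph (triRotIsoPow 5 '' F ∩ ↑(trapD M)) (triRotIsoPow 5 x) x' := by
  intro x hx hxD
  obtain ⟨m, hmF, hmn, hpath⟩ := hconn
  have hp := pathIn_map_iso (triRotIsoPow 5) (hpath x hx)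
  have hmD : triRotIsoPow 5 m ∉ (↑(trapD M) : Set (Site 2)) := fun h => by
    have h' := (mem_trapD_iff_triNorm.1 (Finset.mem_coe.1 h)).2
    rw [triNorm_triRotIsoPow] at h'
    exact absurd hmn (not_lt.2 h')
  obtain ⟨a', b, ha', hbD, hbF, hab, hQ⟩ := hp.exit (R := (↑(trapD M) : Set (Site 2))) (Finset.mem_coe.2 hxD) hmD
  obtain ⟨y, hy, rfl⟩ := hbF
  have hyb := hbox y hy
  have hb := triRotIsoPow_five_coord y
  have ha'D := mem_trapD.1 (Finset.mem_coe.1 ha')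
  have hbD' : ¬ ((M : ℤ) < triRotIsoPow 5 y 0 ∧ triRotIsoPow 5 y 0 ≤ 2 * M ∧ -(2 * (M : ℤ)) ≤ triRotIsoPow 5 y 1 ∧
      triRotIsoPow 5 y 0 + triRotIsoPow 5 y 1 ≤ 2 * M) := fun h => hbD (Finset.mem_coe.2 (mem_trapD.2 h))
  rw [hb.1, hb.2] at hbD'
  have hadj := triGraph_adj_coord hab 1
  rw [hb.2] at hadj
  refine ⟨a', mem_trapB.2 ⟨Finset.mem_coe.1 ha', ?_⟩, hQ.mono fun v hv => ⟨hv.2, hv.1⟩⟩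
  omega

/-- **A connection in a square about `(2M, t)` read through `ρ` hangs from the top row** (the
square past the midpoint column on the other side: `M + 4k + 4 ≤ -t`, and above the corner:
`-2M + 2k + 1 ≤ t`). [folklore] -/
theorem hang_top_of_box
    (hbox : ∀ y ∈ F, 2 * (M : ℤ) - (2 * k + 1) ≤ y 0 ∧ y 0 ≤ 2 * M + (2 * k + 1) ∧ t - (2 * k + 1) ≤ y 1 ∧ y 1 ≤ t + (2 * k + 1))
    (hconn : ∃ m ∈ F, 2 * (M : ℤ) < triNorm m ∧ ∀ x ∈ F, PathIn triGraph F x m)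
    (hguard : (M : ℤ) + 4 * k + 4 ≤ -t) (hbot : -(2 * (M : ℤ)) + 4 * k + 2 ≤ t) :
    ∀ x ∈ F, triRotIsoPow 1 x ∈ trapD M →
      ∃ x' ∈ trapU M, PathIn triGraph (triRotIsoPow 1 '' F ∩ ↑(trapD M)) (triRotIsoPow 1 x) x' := by
  intro x hx hxD
  obtain ⟨m, hmF, hmn, hpath⟩ := hconn
  have hp := pathIn_map_iso (triRotIsoPow 1) (hpath x hx)
  have hmD : triRotIsoPow 1 m ∉ (↑(trapD M) : Set (Site 2)) := fun h => by
    have h' := (mem_trapD_iff_triNorm.1 (Finset.mem_coe.1 h)).2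
    rw [triNorm_triRotIsoPow] at h'
    exact absurd hmn (not_lt.2 h')
  obtain ⟨a', b, ha', hbD, hbF, hab, hQ⟩ := hp.exit (R := (↑(trapD M) : Set (Site 2))) (Finset.mem_coe.2 hxD) hmD
  obtain ⟨y, hy, rfl⟩ := hbF
  have hyb := hbox y hy
  have hb := triRotIsoPow_one_coord y
  have ha'D := mem_trapD.1 (Finset.mem_coe.1 ha')
  have hbD' : ¬ ((M : ℤ) < triRotIsoPow 1 y 0 ∧ triRotIsoPow 1 y 0 ≤ 2 * M ∧ -(2 * (M : ℤ)) ≤ triRotIsoPow 1 y 1 ∧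
      triRotIsoPow 1 y 0 + triRotIsoPow 1 y 1 ≤ 2 * M) := fun h => hbD (Finset.mem_coe.2 (mem_trapD.2 h))
  rw [hb.1, hb.2] at hbD'
  have hadj := triGraph_adj_sum hab
  rw [hb.1, hb.2] at hadj
  refine ⟨a', mem_trapU.2 ⟨Finset.mem_coe.1 ha', ?_⟩, hQ.mono fun v hv => ⟨hv.2, hv.1⟩⟩
  omega

/-- **Squares about points of the side `0` read through `ρ⁵` before the midpoint column, through
`ρ` before it on the other side, or through `ρ²`, `ρ³`, `ρ⁴`, miss the trapezoid.** [folklore] -/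
theorem rot_not_mem_trapD_of_box
    (hbox : ∀ y ∈ F, 2 * (M : ℤ) - (2 * k + 1) ≤ y 0 ∧ y 0 ≤ 2 * M + (2 * k + 1) ∧ t - (2 * k + 1) ≤ y 1 ∧ y 1 ≤ t + (2 * k + 1))
    (hlo : -(2 * (M : ℤ)) + 4 * k + 2 ≤ t) (hhi : t + 4 * k + 2 < 0) {d : ℕ}
    (hd : (d = 5 ∧ 2 * (M : ℤ) + t + (4 * k + 2) ≤ M) ∨ (d = 1 ∧ -t + (2 * k + 1) ≤ M) ∨ d = 2 ∨ d = 3 ∨ d = 4) :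
    ∀ y ∈ F, triRotIsoPow d y ∉ trapD M := by
  intro y hy hyD
  have hyb := hbox y hy
  have h0 := (mem_trapD.1 hyD).1
  rcases hd with ⟨rfl, hd⟩ | ⟨rfl, hd⟩ | rfl | rfl | rfl
  · rw [(triRotIsoPow_five_coord y).1] at h0; omega
  · rw [(triRotIsoPow_one_coord y).1] at h0; omega
  · rw [(triRotIsoPow_two_coord y).1] at h0; omega
  · rw [(triRotIsoPow_three_coord y).1] at h0; omega
  · rw [(triRotIsoPow_four_coord y).1] at h0; omega

end Box

/-! ### The midpoint guard and the fence connections of a structure -/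

namespace PairDataB

variable {M n k₀ K : ℕ}

/-- **The midpoint guard** for the tips of all terms (from below and from above) of a structure: no
tip within `8 k_j` of the midpoint `(2M, -M)` of the side, for every scale `j < K`. [cite: Nolin2008, §4.4 Thm. 11 (proof) (arXiv 0711.4948: Thm. 10)] -/
structure MidGuard {T T' : ℕ} {χ : SiteConfig (Site 2)} (_D : PairDataB M n k₀ K T T' χ) : Prop where
  below : ∀ (u : ℕ) (c : Finset (Site 2)) (z : Site 2), (trapDomain M).lowestSeq χ u = some (c, z) →
    ∀ j < K, z 1 + 8 * trapScale k₀ j ≤ -(M : ℤ) ∨ -(M : ℤ) + 8 * trapScale k₀ j ≤ z 1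
  up : ∀ (u : ℕ) (d : Finset (Site 2)) (z : Site 2), (trapDomain M).flip.lowestSeq χ u = some (d, z) →
    ∀ j < K, z 1 + 8 * trapScale k₀ j ≤ -(M : ℤ) ∨ -(M : ℤ) + 8 * trapScale k₀ j ≤ z 1

section Fences

variable {T T' : ℕ} {χ : SiteConfig (Site 2)} (D : PairDataB M n k₀ K T T' χ)

/-- The connection of a fence from below lies in the square of half-width `2 kOf + 1` about its tip `(2M, z₁)`. [folklore] -/
theorem fence_box {u : ℕ} {c : Finset (Site 2)} {z : Site 2} (hu : (trapDomain M).lowestSeq χ u = some (c, z)) :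
    ∀ y ∈ (D.fence hu).F, 2 * (M : ℤ) - (2 * D.kOf hu + 1) ≤ y 0 ∧ y 0 ≤ 2 * M + (2 * D.kOf hu + 1) ∧
      z 1 - (2 * D.kOf hu + 1) ≤ y 1 ∧ y 1 ≤ z 1 + (2 * D.kOf hu + 1) := fun y hy => by
  have hb := fenceSet_box ((D.fence hu).F_subset hy)
  have hz := (trapO_coord (tip_mem hu)).1
  omega

/-- The connection of a fence from above lies in the square of half-width `2 kOfUp + 1` about its tip. [folklore] -/
theorem fenceUp_box {u : ℕ} {d : Finset (Site 2)} {z : Site 2} (hu : (trapDomain M).flip.lowestSeq χ u = some (d, z)) :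
    ∀ y ∈ (D.fenceUp hu).F, 2 * (M : ℤ) - (2 * D.kOfUp hu + 1) ≤ y 0 ∧ y 0 ≤ 2 * M + (2 * D.kOfUp hu + 1) ∧
      z 1 - (2 * D.kOfUp hu + 1) ≤ y 1 ∧ y 1 ≤ z 1 + (2 * D.kOfUp hu + 1) := fun y hy => by
  have hb := fenceSetUp_box ((D.fenceUp hu).F_subset hy)
  have hz := (trapO_coord (tip_mem_trapO (PairDataB.termUp_isCrossing hu))).1
  omega

/-- The connection of a fence from below is joined inside itself to its exterior fence site. [folklore] -/
theorem fence_conn {u : ℕ} {c : Finset (Site 2)} {z : Site 2} (hu : (trapDomain M).lowestSeq χ u = some (c, z)) :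
    ∃ m ∈ (D.fence hu).F, 2 * (M : ℤ) < triNorm m ∧ ∀ x ∈ (D.fence hu).F, PathIn triGraph (D.fence hu).F x m :=
  ⟨_, (D.fence hu).m_mem, (D.fence hu).norm_m (D.one_le_kOf hu) (tip_mem hu), fun _ hx => (D.fence hu).pathIn_to_m hx⟩

/-- The connection of a fence from above is joined inside itself to its exterior fence site. [folklore] -/
theorem fenceUp_conn {u : ℕ} {d : Finset (Site 2)} {z : Site 2} (hu : (trapDomain M).flip.lowestSeq χ u = some (d, z)) :
    ∃ m ∈ (D.fenceUp hu).F, 2 * (M : ℤ) < triNorm m ∧ ∀ x ∈ (D.fenceUp hu).F, PathIn triGraph (D.fenceUp hu).F x m :=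
  ⟨_, (D.fenceUp hu).m_mem, (D.fenceUp hu).norm_m (D.one_le_kOfUp hu) (tip_mem_trapO (PairDataB.termUp_isCrossing hu)),
    fun _ hx => (D.fenceUp hu).pathIn_to_m hx⟩

/-- **All fence sites of a structure read through `ρ^d` hang from the bottom row** (`d = 5` under the
midpoint guard; vacuously for `d = 2, 3, 4`). [folklore] -/
theorem FFB_hang_bottom (hg : D.MidGuard) {d : ℕ} (hd : d = 5 ∨ d = 2 ∨ d = 3 ∨ d = 4) :
    ∀ x ∈ ⇑(triRotIsoPow d) '' D.FFB, x ∈ trapD M →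
      ∃ x' ∈ trapB M, PathIn triGraph (⇑(triRotIsoPow d) '' D.FFB ∩ ↑(trapD M)) x x' := by
  rintro x ⟨y, hy, rfl⟩ hxD
  -- the data of the fence of `y`: square, connection, guard, tip bounds
  obtain ⟨F, k, t, hyF, hFsub, hbox, hconn, hguard, ⟨hlo, hhi⟩, hk⟩ : ∃ (F : Set (Site 2)) (k : ℕ) (t : ℤ), y ∈ F ∧ F ⊆ D.FFB ∧
      (∀ y ∈ F, 2 * (M : ℤ) - (2 * k + 1) ≤ y 0 ∧ y 0 ≤ 2 * M + (2 * k + 1) ∧ t - (2 * k + 1) ≤ y 1 ∧ y 1 ≤ t + (2 * k + 1)) ∧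
      (∃ m ∈ F, 2 * (M : ℤ) < triNorm m ∧ ∀ x ∈ F, PathIn triGraph F x m) ∧
      (t + 8 * k ≤ -(M : ℤ) ∨ -(M : ℤ) + 8 * k ≤ t) ∧ (-(2 * (M : ℤ)) + 8 * k < t ∧ t + 8 * k < 0) ∧ 1 ≤ k := by
    rcases hy with ⟨u, c, z, hu, hyF⟩ | ⟨u, e, z, hu, hyF⟩
    · exact ⟨_, D.kOf hu, z 1, hyF, fun v hv => Or.inl ⟨u, c, z, hu, hv⟩, D.fence_box hu, D.fence_conn hu,
        hg.below u c z hu _ (D.jOf_spec hu).1, D.tip_mid u c z hu _ (D.jOf_spec hu).1, D.one_le_kOf hu⟩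
    · exact ⟨_, D.kOfUp hu, z 1, hyF, fun v hv => Or.inr ⟨u, e, z, hu, hv⟩, D.fenceUp_box hu, D.fenceUp_conn hu,
        hg.up u e z hu _ (D.jOfUp_spec hu).1, D.tip_midUp u e z hu _ (D.jOfUp_spec hu).1, D.one_le_kOfUp hu⟩
  have hsub : ⇑(triRotIsoPow d) '' F ∩ ↑(trapD M) ⊆ ⇑(triRotIsoPow d) '' D.FFB ∩ ↑(trapD M) :=
    Set.inter_subset_inter_left _ (Set.image_mono hFsub)
  rcases hd with rfl | hd
  · rcases hguard with hgd | hgd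
    · exact absurd hxD (rot_not_mem_trapD_of_box hbox (by omega) (by omega) (Or.inl ⟨rfl, by omega⟩) y hyF)
    · obtain ⟨x', hx', hP⟩ := hang_bottom_of_box hbox hconn (by omega) (by omega) y hyF hxD
      exact ⟨x', hx', hP.mono hsub⟩
  · exact absurd hxD (rot_not_mem_trapD_of_box hbox (by omega) (by omega) (Or.inr (Or.inr hd)) y hyF)

/-- **All fence sites of a structure read through `ρ` hang from the top row** (under the midpoint guard). [folklore] -/
theorem FFB_hang_top (hg : D.MidGuard) :
    ∀ x ∈ ⇑(triRotIsoPow 1) '' D.FFB, x ∈ trapD M →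
      ∃ x' ∈ trapU M, PathIn triGraph (⇑(triRotIsoPow 1) '' D.FFB ∩ ↑(trapD M)) x x' := by
  rintro x ⟨y, hy, rfl⟩ hxD
  obtain ⟨F, k, t, hyF, hFsub, hbox, hconn, hguard, ⟨hlo, hhi⟩, hk⟩ : ∃ (F : Set (Site 2)) (k : ℕ) (t : ℤ), y ∈ F ∧ F ⊆ D.FFB ∧
      (∀ y ∈ F, 2 * (M : ℤ) - (2 * k + 1) ≤ y 0 ∧ y 0 ≤ 2 * M + (2 * k + 1) ∧ t - (2 * k + 1) ≤ y 1 ∧ y 1 ≤ t + (2 * k + 1)) ∧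
      (∃ m ∈ F, 2 * (M : ℤ) < triNorm m ∧ ∀ x ∈ F, PathIn triGraph F x m) ∧
      (t + 8 * k ≤ -(M : ℤ) ∨ -(M : ℤ) + 8 * k ≤ t) ∧ (-(2 * (M : ℤ)) + 8 * k < t ∧ t + 8 * k < 0) ∧ 1 ≤ k := by
    rcases hy with ⟨u, c, z, hu, hyF⟩ | ⟨u, e, z, hu, hyF⟩
    · exact ⟨_, D.kOf hu, z 1, hyF, fun v hv => Or.inl ⟨u, c, z, hu, hv⟩, D.fence_box hu, D.fence_conn hu,
        hg.below u c z hu _ (D.jOf_spec hu).1, D.tip_mid u c z hu _ (D.jOf_spec hu).1, D.one_le_kOf hu⟩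
    · exact ⟨_, D.kOfUp hu, z 1, hyF, fun v hv => Or.inr ⟨u, e, z, hu, hv⟩, D.fenceUp_box hu, D.fenceUp_conn hu,
        hg.up u e z hu _ (D.jOfUp_spec hu).1, D.tip_midUp u e z hu _ (D.jOfUp_spec hu).1, D.one_le_kOfUp hu⟩
  have hsub : ⇑(triRotIsoPow 1) '' F ∩ ↑(trapD M) ⊆ ⇑(triRotIsoPow 1) '' D.FFB ∩ ↑(trapD M) :=
    Set.inter_subset_inter_left _ (Set.image_mono hFsub)
  rcases hguard with hgd | hgd
  · obtain ⟨x', hx', hP⟩ := hang_top_of_box hbox hconn (by omega) (by omega) y hyF hxD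
    exact ⟨x', hx', hP.mono hsub⟩
  · exact absurd hxD (rot_not_mem_trapD_of_box hbox (by omega) (by omega) (Or.inr (Or.inl ⟨rfl, by omega⟩)) y hyF)

end Fences

end PairDataB

/-! ### The avoidance hypotheses for rotated frames -/

namespace CrossData

variable {M n k₀ K T₁ T₁' T₂ T₂' : ℕ} {χ₁ χ₂ : SiteConfig (Site 2)} (X : CrossData M n k₀ K T₁ T₁' T₂ T₂' χ₁ χ₂)

/-- **The avoidance hypothesis for `D₂` when the frames are rotations** `φ₁ = ρ^{i₁}`, `φ₂ = ρ^{i₂}`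
(`i₁ ≠ i₂ < 6`), under the midpoint guard on the tips of `D₁`. [cite: Nolin2008, §4.4 Lemma 15 (proof) (arXiv 0711.4948: Lemma 14)] -/
theorem avoid₂_of_rot {i₁ i₂ : ℕ} (hi₁ : i₁ < 6) (hi₂ : i₂ < 6) (hne : i₁ ≠ i₂)
    (hφ₁ : ∀ u, X.φ₁ u = triRotIsoPow i₁ u) (hφ₂ : ∀ u, X.φ₂ u = triRotIsoPow i₂ u) (hg : X.D₁.MidGuard) :
    ∃ (i : Fin 2) (S : Set (Site 2)) (t : Site 2), t ∈ X.D₂.FFB ∧ PathIn triGraph S (X.D₂.a i) t ∧ S ⊆ X.D₂.AsetB ∧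
      ∀ x ∈ S, X.φ₂ x ∉ X.FF𝔉₁ := by
  set d := (i₁ + (6 - i₂)) % 6 with hdd
  have hψ : ∀ u, X.φ₂.symm (X.φ₁ u) = triRotIsoPow d u := fun u => by
    rw [X.φ₂.symm_apply_eq, hφ₁, hφ₂, ← RelIso.symm_apply_eq, triRotIsoPow_symm_comp_apply hi₂.le]
  set Xs : Set (Site 2) := ⇑(triRotIsoPow d) '' X.D₁.FFB with hXs
  have hXarm : ∀ x ∈ Xs, x ∉ X.D₂.armSet := by
    rintro x ⟨y, hy, rfl⟩ hx
    rw [← hψ] at hx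
    exact X.D₁.not_mem_FFB_of_mem_armSet ((X.armSet_corr).2 hx) hy
  have hXF : ∀ x ∈ Xs, x ∉ X.D₂.FFB := by
    rintro x ⟨y, hy, rfl⟩ hx
    rw [← hψ] at hx
    exact X.fence_far y _ hy hx (by rw [RelIso.apply_symm_apply])
  have hd : d = 1 ∨ (d = 5 ∨ d = 2 ∨ d = 3 ∨ d = 4) := by omega
  -- conclusion from a route disjoint from `Xs`
  have concl : ∀ {i : Fin 2} {S : Set (Site 2)} {t : Site 2}, t ∈ X.D₂.FFB → PathIn triGraph S (X.D₂.a i) t →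
      S ⊆ X.D₂.AsetB → Disjoint S Xs →
      ∃ (i : Fin 2) (S : Set (Site 2)) (t : Site 2), t ∈ X.D₂.FFB ∧ PathIn triGraph S (X.D₂.a i) t ∧ S ⊆ X.D₂.AsetB ∧
        ∀ x ∈ S, X.φ₂ x ∉ X.FF𝔉₁ := by
    intro i S t ht hP hSA hdisj
    refine ⟨i, S, t, ht, hP, hSA, fun x hx => ?_⟩
    rintro ⟨y, hy, he⟩
    have hxy : x = triRotIsoPow d y := by rw [← hψ, RelIso.eq_symm_apply, he]
    exact Set.disjoint_left.1 hdisj hx ⟨y, hy, hxy.symm⟩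
  rcases hd with hd1 | hd'
  · obtain ⟨c₂, z₂, hu₂, -⟩ := X.D₂.uMin_spec
    have hX : ∀ x ∈ Xs, x ∈ trapD M → ∃ x' ∈ trapU M, PathIn triGraph (Xs ∩ ↑(trapD M)) x x' := by
      rw [hXs, hd1]; exact X.D₁.FFB_hang_top hg
    obtain ⟨i, S, hP, hSA, hm, hdisj⟩ := X.D₂.route_c_avoid hu₂ hXarm hX fun x hx hxF => hXF x hx (Or.inl ⟨_, c₂, z₂, hu₂, hxF⟩)
    exact concl (Or.inl ⟨_, c₂, z₂, hu₂, hm⟩) hP hSA hdisj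
  · obtain ⟨d₂, z₂, hu₂, -⟩ := X.D₂.uMinUp_spec
    have hX : ∀ x ∈ Xs, x ∈ trapD M → ∃ x' ∈ trapB M, PathIn triGraph (Xs ∩ ↑(trapD M)) x x' := by
      rw [hXs]; exact X.D₁.FFB_hang_bottom hg hd'
    obtain ⟨i, S, hP, hSA, hm, hdisj⟩ := X.D₂.route_d_avoid hu₂ hXarm hX fun x hx hxF => hXF x hx (Or.inr ⟨_, d₂, z₂, hu₂, hxF⟩)
    exact concl (Or.inr ⟨_, d₂, z₂, hu₂, hm⟩) hP hSA hdisj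

/-- **Swapping the two structures.** [folklore] -/
def swap : CrossData M n k₀ K T₂ T₂' T₁ T₁' χ₂ χ₁ where
  D₁ := X.D₂
  D₂ := X.D₁
  φ₁ := X.φ₂
  φ₂ := X.φ₁
  arm0 v := by
    have h := X.arm1 (X.φ₁.symm (X.φ₂ v))
    rw [RelIso.apply_symm_apply, RelIso.symm_apply_apply] at h
    exact h.symm
  arm1 v := by
    have h := X.arm0 (X.φ₁.symm (X.φ₂ v))
    rw [RelIso.apply_symm_apply, RelIso.symm_apply_apply] at h
    exact h.symm
  start0 := X.start1.symm
  start1 := X.start0.symm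
  fence_far x y hx hy h := X.fence_far y x hy hx h.symm

/-- The actual fence sites of `D₁` of the swapped data are those of `D₂`. [folklore] -/
@[simp] theorem swap_FF𝔉₁ : X.swap.FF𝔉₁ = X.FF𝔉₂ := rfl

/-- The actual fence sites of `D₂` of the swapped data are those of `D₁`. [folklore] -/
@[simp] theorem swap_FF𝔉₂ : X.swap.FF𝔉₂ = X.FF𝔉₁ := rfl

/-- **The avoidance hypothesis for `D₁` when the frames are rotations** (by swapping). [cite: Nolin2008, §4.4 Lemma 15 (proof) (arXiv 0711.4948: Lemma 14)] -/
theorem avoid₁_of_rot {i₁ i₂ : ℕ} (hi₁ : i₁ < 6) (hi₂ : i₂ < 6) (hne : i₁ ≠ i₂)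
    (hφ₁ : ∀ u, X.φ₁ u = triRotIsoPow i₁ u) (hφ₂ : ∀ u, X.φ₂ u = triRotIsoPow i₂ u) (hg : X.D₂.MidGuard) :
    ∃ (i : Fin 2) (S : Set (Site 2)) (t : Site 2), t ∈ X.D₁.FFB ∧ PathIn triGraph S (X.D₁.a i) t ∧ S ⊆ X.D₁.AsetB ∧
      ∀ x ∈ S, X.φ₁ x ∉ X.FF𝔉₂ :=
  X.swap.avoid₂_of_rot hi₂ hi₁ hne.symm hφ₂ hφ₁ hg

/-- **Two vertex-disjoint clean routes exiting on different sides, for rotated frames** `φ₁ = ρ^{i₁}`,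
`φ₂ = ρ^{i₂}` (`i₁ ≠ i₂ < 6`) under the midpoint guards on the tips of both structures. [cite: Nolin2008, §4.4 Lemma 15 (proof) (arXiv 0711.4948: Lemma 14, last paragraph)] [cite: Diestel2017, Thm. 3.3.1 and §1.7] -/
theorem exists_two_clean_routes_of_rot {i₁ i₂ : ℕ} (hi₁ : i₁ < 6) (hi₂ : i₂ < 6) (hne : i₁ ≠ i₂)
    (hφ₁ : ∀ u, X.φ₁ u = triRotIsoPow i₁ u) (hφ₂ : ∀ u, X.φ₂ u = triRotIsoPow i₂ u)
    (hg₁ : X.D₁.MidGuard) (hg₂ : X.D₂.MidGuard) :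
    ∃ (e₀ e₁ : X.ExitRef) (S₀ S₁ : Set (Site 2)), e₀.side ≠ e₁.side ∧
      PathIn triGraph S₀ (X.φ₁ (X.D₁.a 0)) e₀.m𝔄 ∧ PathIn triGraph S₁ (X.φ₁ (X.D₁.a 1)) e₁.m𝔄 ∧
      e₀.m𝔄 ∈ e₀.F𝔄 ∧ e₁.m𝔄 ∈ e₁.F𝔄 ∧ S₀ ⊆ X.B𝔅 ∪ e₀.F𝔄 ∧ S₁ ⊆ X.B𝔅 ∪ e₁.F𝔄 ∧ Disjoint S₀ S₁ :=
  X.exists_two_clean_routes (X.avoid₁_of_rot hi₁ hi₂ hne hφ₁ hφ₂ hg₂) (X.avoid₂_of_rot hi₁ hi₂ hne hφ₁ hφ₂ hg₁)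

end CrossData

end Literature.Probability.Percolation
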